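import Summits.BirchSwinnertonDyer.BirchSwinnertonDyer.Theorems.EisensteinDepletionAtTwoStarE1MTwoPrints
import HarnessLib

/-!
# Crux E1M_NSF `DepletedLambdaLawAtTwoModNSF` (stmt-BirchSwinnertonDyer-27021) FROM TWO PRINTS: (F) and UBD — line `star`, ledger form
# (lead star-p1 GEN 23, 2026-08-29)

The end state of line `star` (v19, Theorems/EisensteinDepletionAtTwoStarE1MTwoPrints) proves the parent crux E1M_NSF
(`DepletedLambdaLawAtTwoModNSF`, item 27021) from modularity + (F) + UBD as
`EvenBranch.depletedLambdaLawAtTwoModNSF_of_cuspNonsingular_ubd (hnf) (hF) (hU)`.  But modularity IS the first binder of E1M_NSF, so the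
item's own signature follows from the TWO named facts alone; this file records exactly that shape, `(F) → UBD → DepletedLambdaLawAtTwoModNSF`,
so that the ledger carries the conditional result on item 27021 itself (the sibling file does so for the aside E1M, item 20341).

HONEST FRAMING: a CONDITIONAL RESULT — E1M_NSF is proved MODULO the two named published facts
`gamma1Parametrization_cuspImage_nonsingularReduction` [(F): Conrad–Edixhoven–Stein 2003 §6.1.2 + Katz–Mazur Thm. 12.6.1 + Silverman ATAEC IV.9.1]
and `CalegariDimitrovTang2025_unboundedDenominators` [UBD]; item 27021 is NOT closed by this file; the leaf T-r3₂ and BSD are NOT proved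
(PARTITION D-0054: none — r_an ≥ 2, axis S0; no S0 motion).  No `sorry`, no new definition.
-/

set_option linter.dupNamespace false
set_option autoImplicit false

noncomputable section

namespace Summit.BirchSwinnertonDyer.BirchSwinnertonDyer.Theorems.DepletionAtTwo.StarTwoPrints

open Literature.NumberTheory.EllipticCurves.ModularForms
open Summit.BirchSwinnertonDyer.BirchSwinnertonDyer.Theorems.DepletionAtTwo

/-- **E1M_NSF `DepletedLambdaLawAtTwoModNSF` (stmt-BirchSwinnertonDyer-27021) from the two prints (F) + UBD**, the modularity clause being the
statement's own first binder (fed back as the `exists_isNewformOf` input of `EvenBranch.depletedLambdaLawAtTwoModNSF_of_cuspNonsingular_ubd`).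
CONDITIONAL RESULT (two named facts); 27021 is NOT closed; BSD is not proved.
[cite: GreenbergVatsal2000, §3 Thm. (3.12), display (28)] [cite: ConradEdixhovenStein2003, §6.1.2 proof of Lemma 6.1.6 (p. 381)]
[cite: CalegariDimitrovTang2025, Thm. 1.0.1] -/
theorem depletedLambdaLawAtTwoModNSF_of_twoPrints (hF : gamma1Parametrization_cuspImage_nonsingularReduction)
    (hU : Literature.NumberTheory.Automorphic.CalegariDimitrovTang2025_unboundedDenominators) :
    Summit.BirchSwinnertonDyer.BirchSwinnertonDyer.Theses.EisensteinDepletionAtTwo.DepletedLambdaLawAtTwoModNSF := by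
  intro hmod
  have hnf : exists_isNewformOf := hmod
  exact EvenBranch.depletedLambdaLawAtTwoModNSF_of_cuspNonsingular_ubd hnf hF hU hmod

end Summit.BirchSwinnertonDyer.BirchSwinnertonDyer.Theorems.DepletionAtTwo.StarTwoPrints

end
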